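import Mathlib
import HarnessLib
import Summits.HubbardSuperconductivity.HubbardSuperconductivity.Theorems.KLProgrammeKLRegimeSplitGeoTwoShell

/-!
# K3 ENGINE package, `G`-level v11 (plan g21 (R100): the bundled G move after the ∃-opacity sweep; cell gate-hubbard-kl, seat hubbard-kl-k3c2-p2 g14):
# the DEFERRED TWO-SHELL PACKAGE over the frame-class two-shell AREA predicate, and `klEngGeo11 := klEngGeo10.addTwoShell klTSA`

WHY («(E2)-TWOSHELL-OPAQUE», KL STATUS 2026-08-28 ≈01:57Z, ruling (R100)).  The value lane books the above-resolution (two-shell) part of the slice's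
ph/pp increments into the ABOVE branch of `phGain`/`ppGain` (`klg5_above_of_twoShell`: `a₁, a₂ ≤ 2⁵²`); the two-shell constants of the tree
(`kltb_exists_twoShell_bound` ∃ ε₀ v C₁ C₂, `kltsv_exists_twoShellVolumeBound` ∃ V, `kltl_exists_angular_bound` ∃ Q) are compactness constants with no
numeral, and the interacting-frame version is not in the tree at all.  Cure (the `klE4TF`/`klIsoMomC` pattern): a DEFERRED package over a GEOMETRIC
admissibility predicate — the two-shell AREA law of DECOMP App. E Lemma E.1/E.3 (uniform clause (iii) of `kltb_exists_twoShell_bound`) for the FRAME'S band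
`frameLevel μ K` under `FrameOK`, below a U-threshold — and a SYMBOLIC amendment of both gains by `klTSA·klTwoShellProfile` (`…SplitGeoTwoShell`).
* §1 **`TwoShellFrameAreaAt A u`**: for every `R` (`R.WF2`), `0 < U ≤ u R`, `μ ∈ klWindowC`, `N`, frame `K` with `FrameOK R U N μ K`, shells `0 < ε₁ ≤ ε₂ ≤ klE0`,
  transfer `w` and torus-distance lower bound `0 < r ≤ |w|_𝕋`:
  `vol{k ∈ BZ : |e_K(k)| < ε₁, |e_K(k − w)| ≤ ε₂} ≤ A·ε₁·(ε₂/r + √ε₂)` (`e_K = frameLevel μ K`; ph at transfer `w`, pp at total momentum `−w` by evenness);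
  `.mono`; deferred **`klTwoShellPack`**, **`klTS`** (the area constant), **`klTSU R`** (its U-threshold — a U12b `min` entry), `klTS_nonneg`, `klTSU_pos`,
  `twoShellFrameAreaAt_klTwoShellPack` (choose_spec form); **`klTSA := 2⁶⁰·klTS`** (the gains' amendment coefficient: room `2⁶⁰` for the value closer's EXPLICIT
  area-to-gain conversion numerals), `klTSA_nonneg`.  NO numeric cap is needed on `klTS` (it is consumed only through `phGain/ppGain/CF`, symbolically).
* §2 **`klEngGeo11 := klEngGeo10.addTwoShell klTSA`**, `klEngGeo11_wf`, rfl/order rows (`CF`, `cE4` rfl ⇒ `klE4TF/klE4T6/klE4T` ride, `S`, gains grow,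
  `thermalBar_klEngGeo10_le_klEngGeo11`, `klEngGeo8_CF_add_klE5CFM_le_klEngGeo11_CF`), the BOOKING lines `klTSA_twoShell_le_klEngGeo11_phGain/_ppGain`, and the
  hosting SHAPE **`klEngGeo11_eq_addShellLog : klEngGeo11 = ((klEngGeo8.raiseCF klE5CFM).addTwoShell klTSA).addShellLog (2^52)`** (+ the inner package's
  `_wf/_CF_nonneg/_phGain_nonneg`).
The hosting/closer twins at the new token are `…EngineV8DefsG11Hosting`.  Definitions with bodies + order lemmas; nothing about the model is asserted;
nothing asserts superconductivity.  References: DECOMP App. E Lemma E.1/E.3 (two-shell laws) [cite: Salmhofer1998, Lemma 6].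
-/

noncomputable section

namespace Summit.HubbardSuperconductivity.HubbardSuperconductivity.Theorems.EngineV8

set_option linter.dupNamespace false -- summit = problem name (single-conjunct summit), D-0017

open Real Finset MeasureTheory Literature.MathematicalPhysics.QuantumLattice Literature.Probability.LatticeModels
open Summit.HubbardSuperconductivity.HubbardSuperconductivity.Theorems.KLRegimeSplit
open Summit.HubbardSuperconductivity.HubbardSuperconductivity.Theorems.KLProgrammeLegKernels
open Summit.HubbardSuperconductivity.HubbardSuperconductivity.Theorems.DispersionFlow

/-! ## §1 The frame-class two-shell area predicate and the deferred package -/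

/-- **`TwoShellFrameAreaAt A u`** — «`A` is a two-shell AREA constant for every admissible frame below the threshold `u`»: for every `R` (`R.WF2`),
`0 < U ≤ u R`, `μ ∈ klWindowC`, `N`, `K` with `FrameOK R U N μ K`, every pair of shell widths `0 < ε₁ ≤ ε₂ ≤ klE0`, every transfer `w` and every lower bound
`0 < r ≤ |w|_𝕋` of its torus sup-distance to `2πℤ²`:
`vol{k ∈ [-π,π)² : |e_K(k)| < ε₁ ∧ |e_K(k − w)| ≤ ε₂} ≤ A·ε₁·(ε₂/r + √ε₂)` — DECOMP App. E Lemma E.1 (`ε₂/|w|` law) / E.3 (`√ε₂` law), uniform form.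
The FREE-band instance (`K = 0`) is `kltb_exists_twoShell_bound` (iii); the frame-class witness is the value lane's (T+). -/
def TwoShellFrameAreaAt (A : ℝ) (u : RenConsts → ℝ) : Prop :=
  ∀ (R : RenConsts), R.WF2 → ∀ (U : ℝ), 0 < U → U ≤ u R → ∀ μ ∈ klWindowC, ∀ (N : ℕ) (K : TrigPolyC4v), FrameOK R U N μ K →
    ∀ (ε₁ ε₂ : ℝ), 0 < ε₁ → ε₁ ≤ ε₂ → ε₂ ≤ klE0 → ∀ (w : Momentum) (r : ℝ), 0 < r → r ≤ torusSupNorm (w 0, w 1) →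
      volume {k : Momentum | k ∈ brillouinZone ∧ |frameLevel μ K k| < ε₁ ∧ |frameLevel μ K (k - w)| ≤ ε₂} ≤
        ENNReal.ofReal (A * ε₁ * (ε₂ / r + Real.sqrt ε₂))

/-- A larger constant and a smaller threshold are still admissible (`0 ≤ A ≤ A′`). -/
theorem TwoShellFrameAreaAt.mono {A A' : ℝ} {u u' : RenConsts → ℝ} (h : TwoShellFrameAreaAt A u) (hAA' : A ≤ A') (huu' : ∀ R, u' R ≤ u R) :
    TwoShellFrameAreaAt A' u' := by
  intro R hR U hU hUu μ hμ N K hK ε₁ ε₂ hε₁ h12 h2 w r hr hrw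
  refine (h R hR U hU (hUu.trans (huu' R)) μ hμ N K hK ε₁ ε₂ hε₁ h12 h2 w r hr hrw).trans (ENNReal.ofReal_le_ofReal ?_)
  have hε₂ : 0 ≤ ε₂ := hε₁.le.trans h12
  have : 0 ≤ ε₁ * (ε₂ / r + Real.sqrt ε₂) := by positivity
  nlinarith

open Classical in
/-- **`klTwoShellPack`** — THE two-shell package of the engine: an admissible pair `(A, u)` with `0 ≤ A` and `u > 0` pointwise when one exists, `(0, 1)` otherwise. -/
def klTwoShellPack : ℝ × (RenConsts → ℝ) :=
  if h : (∃ Au : ℝ × (RenConsts → ℝ), 0 ≤ Au.1 ∧ (∀ R, 0 < Au.2 R) ∧ TwoShellFrameAreaAt Au.1 Au.2) then Classical.choose h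
  else (0, fun _ => 1)

/-- **`klTS`** — the deferred two-shell AREA constant (absolute, opaque; enters `G` only through `addTwoShell`). -/
def klTS : ℝ := klTwoShellPack.1

/-- **`klTSU R`** — the deferred two-shell U-threshold (a U12b `min` entry). -/
def klTSU : RenConsts → ℝ := klTwoShellPack.2

/-- `0 ≤ klTS`. -/
theorem klTS_nonneg : 0 ≤ klTS := by
  classical
  unfold klTS klTwoShellPack
  split_ifs with h
  · exact (Classical.choose_spec h).1
  · exact le_rfl

/-- `0 < klTSU R`. -/
theorem klTSU_pos (R : RenConsts) : 0 < klTSU R := by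
  classical
  unfold klTSU klTwoShellPack
  split_ifs with h
  · exact (Classical.choose_spec h).2.1 R
  · exact one_pos

/-- **`(klTS, klTSU)` is admissible as soon as any package is** (the form in which the value lane's witness theorem is consumed). -/
theorem twoShellFrameAreaAt_klTwoShellPack {A : ℝ} {u : RenConsts → ℝ} (hA : 0 ≤ A) (hu : ∀ R, 0 < u R) (h : TwoShellFrameAreaAt A u) :
    TwoShellFrameAreaAt klTS klTSU := by
  classical
  have hex : ∃ Au : ℝ × (RenConsts → ℝ), 0 ≤ Au.1 ∧ (∀ R, 0 < Au.2 R) ∧ TwoShellFrameAreaAt Au.1 Au.2 := ⟨(A, u), hA, hu, h⟩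
  have hp : klTwoShellPack = Classical.choose hex := by unfold klTwoShellPack; exact dif_pos hex
  have h1 : klTS = (Classical.choose hex).1 := by unfold klTS; rw [hp]
  have h2 : klTSU = (Classical.choose hex).2 := by unfold klTSU; rw [hp]
  rw [h1, h2]
  exact (Classical.choose_spec hex).2.2

/-- **`klTSA := 2⁶⁰·klTS`** — the gains' amendment coefficient (room `2⁶⁰` for the value closer's explicit area-to-gain conversion numerals). -/
def klTSA : ℝ := 2 ^ 60 * klTS

/-- `klTSA = 2⁶⁰·klTS`. -/
theorem klTSA_eq : klTSA = 2 ^ 60 * klTS := rfl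

/-- `0 ≤ klTSA`. -/
theorem klTSA_nonneg : 0 ≤ klTSA := by have := klTS_nonneg; unfold klTSA; positivity

/-- **The conversion room**: `N ≤ 2⁶⁰ ⟹ N·klTS ≤ klTSA` (`0 ≤` everything). -/
theorem mul_klTS_le_klTSA {N : ℝ} (hN : N ≤ 2 ^ 60) : N * klTS ≤ klTSA := by
  unfold klTSA; exact mul_le_mul_of_nonneg_right hN klTS_nonneg

/-! ## §2 The token `klEngGeo11` -/

/-- **`klEngGeo11` — the engine-flow package's absolute constants `G`, v11**: `klEngGeo10` with BOTH bubble gains amended by `klTSA·klTwoShellProfile` and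
`CF := CF + 4·klTSA`; nothing else moved (`cE4`, `S`, `SL`, `Bf`, blocks, drive untouched). -/
def klEngGeo11 : GeoConsts := klEngGeo10.addTwoShell klTSA

/-- `klEngGeo11 = klEngGeo10.addTwoShell klTSA` (`rfl`). -/
theorem klEngGeo11_eq : klEngGeo11 = klEngGeo10.addTwoShell klTSA := rfl

/-- `klEngGeo11` is well formed. -/
theorem klEngGeo11_wf : klEngGeo11.WF := GeoConsts.addTwoShell_wf klEngGeo10_wf klTSA_nonneg

/-- `klEngGeo11.CF = klEngGeo10.CF + 4·klTSA`. -/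
theorem klEngGeo11_CF : klEngGeo11.CF = klEngGeo10.CF + 4 * klTSA := rfl

/-- `klEngGeo10.CF ≤ klEngGeo11.CF`. -/
theorem klEngGeo10_CF_le_klEngGeo11_CF : klEngGeo10.CF ≤ klEngGeo11.CF := GeoConsts.CF_le_addTwoShell klTSA_nonneg

/-- `klEngGeo9.CF ≤ klEngGeo11.CF`. -/
theorem klEngGeo9_CF_le_klEngGeo11_CF : klEngGeo9.CF ≤ klEngGeo11.CF := klEngGeo9_CF_le_klEngGeo10_CF.trans klEngGeo10_CF_le_klEngGeo11_CF

/-- `klEngGeo8.CF ≤ klEngGeo11.CF`. -/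
theorem klEngGeo8_CF_le_klEngGeo11_CF : klEngGeo8.CF ≤ klEngGeo11.CF := klEngGeo8_CF_le_klEngGeo10_CF.trans klEngGeo10_CF_le_klEngGeo11_CF

/-- **`klEngGeo8.CF + klE5CFM ≤ klEngGeo11.CF`** (the class-#6 fit's CF hypothesis rides). -/
theorem klEngGeo8_CF_add_klE5CFM_le_klEngGeo11_CF : klEngGeo8.CF + klE5CFM ≤ klEngGeo11.CF :=
  klEngGeo8_CF_add_klE5CFM_le_klEngGeo10_CF.trans klEngGeo10_CF_le_klEngGeo11_CF

/-- `klIsoT ^ 4 ≤ klEngGeo11.CF` (rides). -/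
theorem klIsoT_pow_four_le_klEngGeo11_CF : klIsoT ^ 4 ≤ klEngGeo11.CF := klIsoT_pow_four_le_klEngGeo10_CF.trans klEngGeo10_CF_le_klEngGeo11_CF

/-- `0 ≤ klEngGeo11.CF`. -/
theorem klEngGeo11_CF_nonneg : 0 ≤ klEngGeo11.CF := klEngGeo10_CF_nonneg.trans klEngGeo10_CF_le_klEngGeo11_CF

/-- the amended ph gain -/
theorem klEngGeo11_phGain (n : ℕ) (ρ : ℝ) : klEngGeo11.phGain n ρ = klEngGeo10.phGain n ρ + klTSA * klTwoShellProfile n ρ := rfl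
/-- the amended pp gain -/
theorem klEngGeo11_ppGain (n : ℕ) (ρ : ℝ) : klEngGeo11.ppGain n ρ = klEngGeo10.ppGain n ρ + klTSA * klTwoShellProfile n ρ := rfl
/-- the ph gain grows from `klEngGeo10` -/
theorem klEngGeo10_phGain_le_klEngGeo11_phGain (n : ℕ) (ρ : ℝ) : klEngGeo10.phGain n ρ ≤ klEngGeo11.phGain n ρ :=
  GeoConsts.phGain_le_addTwoShell klTSA_nonneg n ρ
/-- the pp gain grows from `klEngGeo10` -/
theorem klEngGeo10_ppGain_le_klEngGeo11_ppGain (n : ℕ) (ρ : ℝ) : klEngGeo10.ppGain n ρ ≤ klEngGeo11.ppGain n ρ :=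
  GeoConsts.ppGain_le_addTwoShell klTSA_nonneg n ρ

/-- **THE BOOKING LINE (ph) at the token**: `klTSA·klTwoShellProfile n ρ ≤ klEngGeo11.phGain n ρ`. -/
theorem klTSA_twoShell_le_klEngGeo11_phGain (n : ℕ) (ρ : ℝ) : klTSA * klTwoShellProfile n ρ ≤ klEngGeo11.phGain n ρ :=
  GeoConsts.twoShell_le_addTwoShell_phGain (klEngGeo10_wf.2.2.2.2.2.2.2.2.2.2.2.2.1 n ρ)

/-- **THE BOOKING LINE (pp) at the token**: `klTSA·klTwoShellProfile n ρ ≤ klEngGeo11.ppGain n ρ`. -/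
theorem klTSA_twoShell_le_klEngGeo11_ppGain (n : ℕ) (ρ : ℝ) : klTSA * klTwoShellProfile n ρ ≤ klEngGeo11.ppGain n ρ :=
  GeoConsts.twoShell_le_addTwoShell_ppGain (klEngGeo10_wf.2.2.2.2.2.2.2.2.2.2.2.1 n ρ)

/-- untouched field `cE4` (so `klE4TF`, `klE4T6`, `klE4T` ride). -/
theorem klEngGeo11_cE4 : klEngGeo11.cE4 = klEngGeo10.cE4 := rfl
/-- `klE4TF ≤ klEngGeo11.cE4`. -/
theorem klE4TF_le_klEngGeo11_cE4 : klE4TF ≤ klEngGeo11.cE4 := klE4TF_le_klEngGeo10_cE4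
/-- `klE4T6 ≤ klEngGeo11.cE4`. -/
theorem klE4T6_le_klEngGeo11_cE4 : klE4T6 ≤ klEngGeo11.cE4 := klE4T6_le_klEngGeo10_cE4
/-- `klE4T ≤ klEngGeo11.cE4`. -/
theorem klE4T_le_klEngGeo11_cE4 : klE4T ≤ klEngGeo11.cE4 := klE4T_le_klEngGeo10_cE4
/-- untouched field `S`. -/
theorem klEngGeo11_S : klEngGeo11.S = klEngGeo10.S := rfl
/-- `klS6 j ≤ klEngGeo11.S j` (rides). -/
theorem klS6_le_klEngGeo11_S (j : ℕ) : klS6 j ≤ klEngGeo11.S j := klS6_le_klEngGeo10_S j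
/-- untouched field `SL`. -/
theorem klEngGeo11_SL : klEngGeo11.SL = klEngGeo10.SL := rfl
/-- untouched field `Bf`. -/
theorem klEngGeo11_Bf : klEngGeo11.Bf = klEngGeo10.Bf := rfl
/-- untouched field `bhi`. -/
theorem klEngGeo11_bhi : klEngGeo11.bhi = klEngGeo10.bhi := rfl
/-- untouched field `blo`. -/
theorem klEngGeo11_blo : klEngGeo11.blo = klEngGeo10.blo := rfl
/-- untouched field `aplus`. -/
theorem klEngGeo11_aplus : klEngGeo11.aplus = klEngGeo10.aplus := rfl
/-- untouched field `ζ`. -/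
theorem klEngGeo11_ζ : klEngGeo11.ζ = klEngGeo10.ζ := rfl
/-- untouched field `Z`. -/
theorem klEngGeo11_Z : klEngGeo11.Z = klEngGeo10.Z := rfl
/-- untouched field `cloc`. -/
theorem klEngGeo11_cloc : klEngGeo11.cloc = klEngGeo10.cloc := rfl
/-- untouched field `θ`. -/
theorem klEngGeo11_θ : klEngGeo11.θ = klEngGeo10.θ := rfl
/-- untouched field `a`. -/
theorem klEngGeo11_a : klEngGeo11.a = klEngGeo10.a := rfl
/-- untouched field `atop`. -/
theorem klEngGeo11_atop : klEngGeo11.atop = klEngGeo10.atop := rfl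
/-- untouched field `abot`. -/
theorem klEngGeo11_abot : klEngGeo11.abot = klEngGeo10.abot := rfl

/-- `thermalBar` at `klEngGeo10` is below `thermalBar` at `klEngGeo11`. -/
theorem thermalBar_klEngGeo10_le_klEngGeo11 (P : SplitConsts) (U β : ℝ) (n : ℕ) :
    thermalBar klEngGeo10 P U β n ≤ thermalBar klEngGeo11 P U β n :=
  thermalBar_le_addTwoShell klTSA klTSA_nonneg P U β n

/-- **`pred_le` at the token from `pred_le` at `klEngGeo10`.** -/
theorem klEngGeo11_phGain_pred_le {n : ℕ} {ρ : ℝ} (h : klEngGeo10.phGain (n - 1) ρ ≤ 4 * klEngGeo10.phGain n ρ) :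
    klEngGeo11.phGain (n - 1) ρ ≤ 4 * klEngGeo11.phGain n ρ :=
  GeoConsts.addTwoShell_phGain_pred_le klTSA_nonneg h

/-! ### The hosting SHAPE of the token: `klEngGeo11 = ((klEngGeo8.raiseCF klE5CFM).addTwoShell klTSA).addShellLog (2 ^ 52)` -/

/-- **The `addShellLog` shape of the token**: `klEngGeo11 = ((klEngGeo8.raiseCF klE5CFM).addTwoShell klTSA).addShellLog (2 ^ 52)` (propositional: the gains add
in either order, the `CF` sums re-associate). -/
theorem klEngGeo11_eq_addShellLog : klEngGeo11 = ((klEngGeo8.raiseCF klE5CFM).addTwoShell klTSA).addShellLog (2 ^ 52) := by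
  rw [klEngGeo11_eq, klEngGeo10_eq_addShellLog]
  exact GeoConsts.addTwoShell_addShellLog_comm _ _ _

/-- The inner package `(klEngGeo8.raiseCF klE5CFM).addTwoShell klTSA` is well formed. -/
theorem klEngGeo8_raiseCF_addTwoShell_wf : ((klEngGeo8.raiseCF klE5CFM).addTwoShell klTSA).WF :=
  GeoConsts.addTwoShell_wf klEngGeo8_raiseCF_wf klTSA_nonneg

/-- `0 ≤ ((klEngGeo8.raiseCF klE5CFM).addTwoShell klTSA).CF`. -/
theorem klEngGeo8_raiseCF_addTwoShell_CF_nonneg : 0 ≤ ((klEngGeo8.raiseCF klE5CFM).addTwoShell klTSA).CF :=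
  klEngGeo8_raiseCF_CF_nonneg.trans (GeoConsts.CF_le_addTwoShell klTSA_nonneg)

/-- `0 ≤ ((klEngGeo8.raiseCF klE5CFM).addTwoShell klTSA).phGain n ρ`. -/
theorem klEngGeo8_raiseCF_addTwoShell_phGain_nonneg (n : ℕ) (ρ : ℝ) : 0 ≤ ((klEngGeo8.raiseCF klE5CFM).addTwoShell klTSA).phGain n ρ :=
  (klEngGeo8_raiseCF_phGain_nonneg n ρ).trans (GeoConsts.phGain_le_addTwoShell klTSA_nonneg n ρ)

end Summit.HubbardSuperconductivity.HubbardSuperconductivity.Theorems.EngineV8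

end
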